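import Mathlib
import HarnessLib
import Literature.MathematicalPhysics.StatisticalMechanics.RenormalisationMapLipschitzSubABKM
import Literature.MathematicalPhysics.StatisticalMechanics.RenormalisationMapSmallnessTermsTop
import Literature.MathematicalPhysics.StatisticalMechanics.RenormalisationMapSplit
import Literature.MathematicalPhysics.StatisticalMechanics.RenormalisationMapZero
import Literature.MathematicalPhysics.StatisticalMechanics.LinearisedMapLargePart

/-!
# The second remainder sum (large connected preimages, with the large part of `C_k` added back)
# of the renormalisation map is Lipschitz ([ABKM19] Lemma 9.6 / Lemma 10.2 / Thm 6.8)

CH12-PLAN §5 (e2), third assembled piece (companion of RenormalisationMapRemainderThree/Four).  In the decomposition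
`S(H,K)(U) − C_kK(U) = Σ_{blocks} + Σ_{large connected} + Σ_{disconnected} + Σ_{∅≠X₁⊊X}`
(`GradientRG.nextKStep_sub_opC_eq`, RenormalisationMapRemainder) the second sum is
`Σ₂ = Σ_{X ∈ largePartIndex} [(p_X − 1) R K(X) + p_X(R(e^{−H}−1)^X + R rest(X) + (1−e^{−H̃})^X)]`, and with
`R P₂(X) = RK(X) + R(e^{−H}−1)^X + R rest(X)` one has `Σ₂ + Σ_{X ∈ largePartIndex} RK(X) = Σ₂ᴸ` where
`Σ₂ᴸ(H̃,H,K)(U,φ) = Σ_{X ∈ largePartIndex(U)} (e^{−H̃})^{U∖X}(e^{H̃})^{X∖U}·(R_{k+1}[P₂(e^{−H},K)(X)](φ) + (1−e^{−H̃})^X(φ))`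
(the added term is the large part `F(U)` of the linearisation `C_kK(U)`, `LinearisedMapLargePart`, whose own
Lipschitz = linear bound is [ABKM19] Lemma 10.2).  This file proves that `Σ₂ᴸ` is Lipschitz in `(H̃,H,K)` in
`|·|_{T_{k+1}^{U*}, w_{k+1}^U}` with constant
`κ^{|U|_k}(3Δ + Δ_H + C_Δ) ω A⁴ · c₃^{|U|_{k+1}} A^{−η(d)|U|_{k+1}} + κ^{|U|_k}(2Δ + C_Δ) · c₂^{|U|_{k+1}} A^{−η(d)|U|_{k+1}}`
— an `ω`-small part (all terms of degree `≥ 2`: tool + adapter + `sum_reblock_triples_le_pow`) plus the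
degree-one top terms `Y = X` (tool + `reblockTerm_lipschitzConsts_le_top` + `sum_reblock_large_le_pow`: no
`ω`, smallness from Brydges' gain `A^{−(η(d)−1)|U|_{k+1}}` only — the `largePartEps` mechanism of Lemma 10.2).

* **`tayNormLE_remainderTwoLarge_sub_abkm`** — the displayed bound.

Everything is proved; no named fact.

## References
* S. Adams, S. Buchholz, R. Kotecký, S. Müller, arXiv:1910.13564, Theorem 6.8, Lemma 9.6 (proof,
  (9.36)–(9.39)) [AdamsBuchholzKoteckyMuller2019].
* D. C. Brydges, IAS/Park City Math. Ser. 16 (2009), Lemma 6.15 [Brydges2009].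
-/

noncomputable section

namespace Literature.MathematicalPhysics.StatisticalMechanics.GradientRG

open scoped BigOperators Classical
open Finset Matrix
open Literature.MathematicalPhysics.StatisticalMechanics.TorusPolymer
  (IsPolymer blocks polys bprod blockOf reblock mem_polys mem_blocks numBlocks
    card_blocks_eq_numBlocks reblockTerm_lipschitzConsts_le reblockTerm_lipschitzConsts_le_top
    sum_reblock_triples_le_pow sum_reblock_large_le_pow empty_mem_polys self_mem_polys bprod_empty)
open Literature.Barriers.CriticalPhenomena.LongRangePhi4.Polymer (IsConn components)
open Literature.MathematicalPhysics.QuantumFieldTheory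

variable {d M : ℕ} [NeZero M]

/-- **`Σ₂ᴸ` (second remainder sum plus the large part of `C_kK`) is Lipschitz** (module docstring): torus data as in
`tayNormLE_subsum_reblockTerm_sub_abkm`; smallness carriers `≤ ω`, `ω A² ≤ 1`, `A ≥ 1`,
`κ ≥ 1 + e^{1/4} + 16e^{3/8}‖H̃−H̃'‖_{k,0}`; `c(d) = (2^{d+1}+2)^d`, `η(d) = 1 + (2(2^d+1)+6)^{−d}`.
[cite: AdamsBuchholzKoteckyMuller2019, Theorem 6.8 / Lemma 9.6 (proof, first order)] -/
theorem tayNormLE_remainderTwoLarge_sub_abkm {L N Mord R n p r₀ : ℕ} {θbar lam μ δ₁ δ₀ A𝒫 h A : ℝ}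
    {𝒞 : ℕ → (Fin d → ZMod M) → ℝ} (hd : 3 ≤ d) (hLodd : Odd L) (hL : 2 ^ (d + 3) + 16 * R ≤ L)
    (hR2 : 2 ≤ R) (hM : M = L ^ N) {k : ℕ} (hkN : k + 1 ≤ N) (hp : d / 2 + 1 ≤ p) (hMord : d / 2 + 1 ≤ Mord)
    (hθbar : 0 < θbar) (hlam : 0 < lam)
    (hB : AbkmWeightBounds L N Mord R n θbar lam μ δ₁ δ₀ A𝒫 𝒞
      (abkmWeightData L N Mord R θbar (schedDelta δ₀ δ₁ N) 𝒞))
    (hδ₀ : 0 < δ₀) (hδ₁ : 0 < δ₁) (hh : 0 < h) (hh0 : hZeroSq d R δ₀ δ₁ ≤ h ^ 2) (hA𝒫 : 0 ≤ A𝒫) (hA1 : 1 ≤ A)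
    {U : Finset (Fin d → ZMod M)} (hU : IsPolymer (L ^ (k + 1)) U)
    {Ht Ht' H H' : RelevantHamiltonian ℂ d} {τ : ℝ}
    (hHt : hamNorm (fieldWt h (L : ℝ) d k) ((L : ℝ) ^ k) (L ^ (d * k)) Ht ≤ τ)
    (hHt' : hamNorm (fieldWt h (L : ℝ) d k) ((L : ℝ) ^ k) (L ^ (d * k)) Ht' ≤ τ) (hτ : τ ≤ 1 / 16)
    (hH : hamNorm (fieldWt h (L : ℝ) d k) ((L : ℝ) ^ k) (L ^ (d * k)) H ≤ 1 / 16)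
    (hH' : hamNorm (fieldWt h (L : ℝ) d k) ((L : ℝ) ^ k) (L ^ (d * k)) H' ≤ 1 / 16)
    {K K' : Finset (Fin d → ZMod M) → ((Fin d → ZMod M) → ℝ) → ℂ} {C CΔ : ℝ} (hC : 0 ≤ C) (hCΔ : 0 ≤ CΔ)
    (hK : WeakNormLE (abkmNormParams L N Mord R p r₀ h θbar A (schedDelta δ₀ δ₁ N) 𝒞) k K C)
    (hK' : WeakNormLE (abkmNormParams L N Mord R p r₀ h θbar A (schedDelta δ₀ δ₁ N) 𝒞) k K' C)
    (hΔ : WeakNormLE (abkmNormParams L N Mord R p r₀ h θbar A (schedDelta δ₀ δ₁ N) 𝒞) k (K - K') CΔ)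
    (hKfac : Factorises (L ^ k) K) (hK0 : ∀ φ, K ∅ φ = 1) (hKd : ∀ Y, ContDiff ℝ r₀ (K Y))
    (hK'fac : Factorises (L ^ k) K') (hK'0 : ∀ φ, K' ∅ φ = 1) (hK'd : ∀ Y, ContDiff ℝ r₀ (K' Y))
    (hKloc : ∀ Y, IsPolymer (L ^ k) Y → IsConn Y →
      IsGaugeLocal ((abkmNormParams L N Mord R p r₀ h θbar A (schedDelta δ₀ δ₁ N) 𝒞).gauge k Y) (K Y))
    (hK'loc : ∀ Y, IsPolymer (L ^ k) Y → IsConn Y →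
      IsGaugeLocal ((abkmNormParams L N Mord R p r₀ h θbar A (schedDelta δ₀ δ₁ N) 𝒞).gauge k Y) (K' Y))
    {ω κ : ℝ}
    (hθω : 8 * Real.exp (1 / 4) * τ +
      16 * Real.exp (3 / 8) * hamNorm (fieldWt h (L : ℝ) d k) ((L : ℝ) ^ k) (L ^ (d * k)) (Ht - Ht') ≤ ω)
    (hbω : 8 * Real.exp (1 / 4) * hamNorm (fieldWt h (L : ℝ) d k) ((L : ℝ) ^ k) (L ^ (d * k)) H ≤ ω)
    (hb'ω : 8 * Real.exp (1 / 4) * hamNorm (fieldWt h (L : ℝ) d k) ((L : ℝ) ^ k) (L ^ (d * k)) H' +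
      16 * Real.exp (3 / 8) * hamNorm (fieldWt h (L : ℝ) d k) ((L : ℝ) ^ k) (L ^ (d * k)) (H - H') ≤ ω)
    (hCω : C + CΔ ≤ ω) (hωA : ω * A ^ 2 ≤ 1)
    (hκ : 1 + Real.exp (1 / 4) +
      16 * Real.exp (3 / 8) * hamNorm (fieldWt h (L : ℝ) d k) ((L : ℝ) ^ k) (L ^ (d * k)) (Ht - Ht') ≤ κ) :
    TayNormLE ((abkmNormParams L N Mord R p r₀ h θbar A (schedDelta δ₀ δ₁ N) 𝒞).gauge (k + 1) U) r₀
      ((abkmWeightData L N Mord R θbar (schedDelta δ₀ δ₁ N) 𝒞).weight (k + 1) U)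
      (fun φ => ∑ X ∈ largePartIndex (L ^ k) L U,
        (bprod (L ^ k) (fun B => expNegH Ht B φ) (U \ X) * bprod (L ^ k) (fun B => expNegH (-Ht) B φ) (X \ U) *
            (fluct (𝒞 (k + 1)) (polyP2 (L ^ k) H K X) φ + bprod (L ^ k) (fun B => 1 - expNegH Ht B φ) X) -
          bprod (L ^ k) (fun B => expNegH Ht' B φ) (U \ X) * bprod (L ^ k) (fun B => expNegH (-Ht') B φ) (X \ U) *
            (fluct (𝒞 (k + 1)) (polyP2 (L ^ k) H' K' X) φ + bprod (L ^ k) (fun B => 1 - expNegH Ht' B φ) X)))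
      (κ ^ (blocks (L ^ k) U).card *
          ((3 * (16 * Real.exp (3 / 8) * hamNorm (fieldWt h (L : ℝ) d k) ((L : ℝ) ^ k) (L ^ (d * k)) (Ht - Ht')) +
              16 * Real.exp (3 / 8) * hamNorm (fieldWt h (L : ℝ) d k) ((L : ℝ) ^ k) (L ^ (d * k)) (H - H') + CΔ) *
            (ω * A ^ 4)) *
        (((2 * (2 * κ * max 1 A𝒫)) ^ ((2 ^ (d + 1) + 2) ^ d * L ^ d) * (4 : ℝ) ^ ((2 ^ (d + 1) + 2) ^ d * L ^ d)) ^
            (blocks (L * L ^ k) U).card *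
          A ^ (-((1 + 1 / ((2 * (2 ^ d + 1) + 6 : ℝ) ^ d)) * (blocks (L * L ^ k) U).card) : ℝ)) +
      κ ^ (blocks (L ^ k) U).card *
          (2 * (16 * Real.exp (3 / 8) * hamNorm (fieldWt h (L : ℝ) d k) ((L : ℝ) ^ k) (L ^ (d * k)) (Ht - Ht')) + CΔ) *
        (((2 * κ * max 1 A𝒫) ^ ((2 ^ (d + 1) + 2) ^ d * L ^ d) * (2 : ℝ) ^ ((2 ^ (d + 1) + 2) ^ d * L ^ d)) ^
            (blocks (L * L ^ k) U).card *
          A ^ (-((1 + 1 / ((2 * (2 ^ d + 1) + 6 : ℝ) ^ d)) * (blocks (L * L ^ k) U).card) : ℝ))) := by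
  have hA : 0 < A := by linarith
  set P := abkmNormParams L N Mord R p r₀ h θbar A (schedDelta δ₀ δ₁ N) 𝒞 with hP
  set T := (polys (L ^ k) univ).filter (fun X => reblock (L ^ k) (L * L ^ k) X = U) with hT
  set T₂ := largePartIndex (L ^ k) L U with hT₂
  have hT₂T : T₂ ⊆ T := by
    intro X hX
    obtain ⟨hXp, -, -, hXU⟩ := mem_largePartIndex.1 hX
    exact mem_filter.2 ⟨mem_polys.2 ⟨subset_univ _, hXp⟩, hXU⟩
  have hT₂p : ∀ X ∈ T₂, IsPolymer (L ^ k) X := fun X hX => (mem_largePartIndex.1 hX).1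
  have hT₂c : ∀ X ∈ T₂, IsConn X := fun X hX => (mem_largePartIndex.1 hX).2.1
  have hT₂two : ∀ X ∈ T₂, 2 ≤ (blocks (L ^ k) X).card := fun X hX => (mem_largePartIndex.1 hX).2.2.1
  have hT₂ne : ∀ X ∈ T₂, X.Nonempty := fun X hX => (hT₂c X hX).1
  have h𝓨 : ∀ X ∈ T₂, ({∅, X} : Finset (Finset (Fin d → ZMod M))) ⊆ polys (L ^ k) X := by
    intro X hX X₁ hX₁
    rcases mem_insert.1 hX₁ with rfl | h1
    · exact empty_mem_polys _ _
    · rw [mem_singleton.1 h1]; exact self_mem_polys (hT₂p X hX)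
  -- the explicit per-term Lipschitz bound, summed over `X₁ ∈ {∅, X}`
  have htool := tayNormLE_subsum_reblockTerm_sub_abkm (n := n) (lam := lam) (μ := μ) hd hLodd hL hR2 hM hkN hp
    hMord hθbar hlam hB hδ₀ hδ₁ hh hh0 hA𝒫 hA hU (𝓧' := T₂) hT₂T
    (𝓨 := fun X => ({∅, X} : Finset (Finset (Fin d → ZMod M)))) h𝓨
    hHt hHt' hτ hH hH' hC hCΔ hK hK' hΔ hKfac hK0 hKd hK'fac hK'0 hK'd hKloc hK'loc
  -- the two reblocked terms `X₁ = ∅`, `X₁ = X` of a preimage are the `Σ₂ᴸ` summand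
  have hfun : (fun φ : (Fin d → ZMod M) → ℝ => ∑ X ∈ T₂, ∑ X₁ ∈ ({∅, X} : Finset (Finset (Fin d → ZMod M))),
      (bprod (L ^ k) (fun B => expNegH Ht B φ) (U \ X) * bprod (L ^ k) (fun B => expNegH (-Ht) B φ) (X \ U) *
          (bprod (L ^ k) (fun B => 1 - expNegH Ht B φ) X₁ * fluct (𝒞 (k + 1)) (polyP2 (L ^ k) H K (X \ X₁)) φ) -
        bprod (L ^ k) (fun B => expNegH Ht' B φ) (U \ X) * bprod (L ^ k) (fun B => expNegH (-Ht') B φ) (X \ U) *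
          (bprod (L ^ k) (fun B => 1 - expNegH Ht' B φ) X₁ *
            fluct (𝒞 (k + 1)) (polyP2 (L ^ k) H' K' (X \ X₁)) φ))) =
      fun φ => ∑ X ∈ T₂,
        (bprod (L ^ k) (fun B => expNegH Ht B φ) (U \ X) * bprod (L ^ k) (fun B => expNegH (-Ht) B φ) (X \ U) *
            (fluct (𝒞 (k + 1)) (polyP2 (L ^ k) H K X) φ + bprod (L ^ k) (fun B => 1 - expNegH Ht B φ) X) -
          bprod (L ^ k) (fun B => expNegH Ht' B φ) (U \ X) * bprod (L ^ k) (fun B => expNegH (-Ht') B φ) (X \ U) *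
            (fluct (𝒞 (k + 1)) (polyP2 (L ^ k) H' K' X) φ + bprod (L ^ k) (fun B => 1 - expNegH Ht' B φ) X)) := by
    funext φ
    refine sum_congr rfl fun X hX => ?_
    rw [sum_pair (hT₂ne X hX).ne_empty.symm]
    simp only [bprod_empty, sdiff_empty, Finset.sdiff_self, polyP2_empty _ _ hK0, polyP2_empty _ _ hK'0,
      fluct_const]
    ring
  rw [hfun] at htool
  refine htool.mono ?_ (fun _ => (Real.exp_pos _).le)
  -- sizes and parities
  have h2dle : 2 ^ d ≤ 2 ^ (d + 3) := Nat.pow_le_pow_right (by norm_num) (by omega)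
  have h1le : 1 ≤ 2 ^ d := Nat.one_le_two_pow
  have hL2 : 2 ^ d + 1 ≤ L := by omega
  have hL4 : 4 ≤ L := by omega
  have hMo : Odd M := by rw [hM]; exact hLodd.pow
  have hsodd : Odd (L ^ k) := hLodd.pow
  have hU' : IsPolymer (L * L ^ k) U := by
    rw [show L * L ^ k = L ^ (k + 1) by rw [pow_succ']]; exact hU
  -- nonnegativity of the letters
  have hnn : ∀ H₀ : RelevantHamiltonian ℂ d,
      0 ≤ hamNorm (fieldWt h (L : ℝ) d k) ((L : ℝ) ^ k) (L ^ (d * k)) H₀ := fun H₀ =>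
    hamNorm_nonneg (fieldWt_pos hh (by exact_mod_cast hLodd.pos) d k).le (by positivity) _ H₀
  have hτ0 : 0 ≤ τ := (hnn Ht).trans hHt
  have haF : ∀ Z, P.aFactor k Z = (A ^ (blocks (L ^ k) Z).card)⁻¹ := fun Z => by
    rw [hP, NormParams.aFactor, abkmNormParams_A, abkmNormParams_L, card_blocks_eq_numBlocks]
  have h3 : 0 ≤ (16 * Real.exp (3 / 8) * hamNorm (fieldWt h (L : ℝ) d k) ((L : ℝ) ^ k) (L ^ (d * k)) (Ht - Ht')) := mul_nonneg (by positivity) (hnn _)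
  have hκ1 : 1 ≤ κ := by have := Real.exp_pos (1 / 4 : ℝ); linarith
  have hκ0 : 0 ≤ κ := by linarith
  have hω0 : 0 ≤ ω := le_trans (by have := hnn H; positivity) hbω
  -- the two constants `E` (ω-small part) and `E₂` (top terms)
  set E : ℝ := κ ^ (blocks (L ^ k) U).card * ((3 * (16 * Real.exp (3 / 8) * hamNorm (fieldWt h (L : ℝ) d k) ((L : ℝ) ^ k) (L ^ (d * k)) (Ht - Ht')) + 16 * Real.exp (3 / 8) * hamNorm (fieldWt h (L : ℝ) d k) ((L : ℝ) ^ k) (L ^ (d * k)) (H - H') + CΔ) * (ω * A ^ 4)) with hE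
  set E₂ : ℝ := κ ^ (blocks (L ^ k) U).card * (2 * (16 * Real.exp (3 / 8) * hamNorm (fieldWt h (L : ℝ) d k) ((L : ℝ) ^ k) (L ^ (d * k)) (Ht - Ht')) + CΔ) with hE₂
  have hE0 : 0 ≤ E := by have h2 := hnn (H - H'); rw [hE]; positivity
  have hE₂0 : 0 ≤ E₂ := by rw [hE₂]; positivity
  have hc1 : (1 : ℝ) ≤ 2 * κ * max 1 A𝒫 := by
    have hm1 := le_max_left (1 : ℝ) A𝒫
    have hκm : (1 : ℝ) * 1 ≤ κ * max 1 A𝒫 := mul_le_mul hκ1 hm1 zero_le_one (by linarith)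
    linarith
  set c : ℝ := 2 * κ * max 1 A𝒫 with hc
  -- the majorants
  set G : Finset (Fin d → ZMod M) → Finset (Fin d → ZMod M) → ℝ := fun X Y =>
    c ^ (blocks (L ^ k) X).card * E *
      (A ^ (2 * (blocks (L ^ k) (X \ Y)).card + (blocks (L ^ k) Y).card + (components Y).card))⁻¹ with hG
  set 𝓩 : Finset (Fin d → ZMod M) → Finset (Fin d → ZMod M) → Finset (Finset (Fin d → ZMod M)) :=
    fun X X₁ => if X₁ = ∅ then (polys (L ^ k) (X \ X₁)).erase X else polys (L ^ k) (X \ X₁) with h𝓩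
  have h𝓩sub : ∀ X ∈ T₂, ∀ X₁ ∈ ({∅, X} : Finset (Finset (Fin d → ZMod M))), 𝓩 X X₁ ⊆ polys (L ^ k) (X \ X₁) := by
    intro X _ X₁ _
    simp only [h𝓩]
    split_ifs
    · exact erase_subset _ _
    · exact Subset.rfl
  -- Step 1: per `X`, the two adapters
  have hstep : ∀ X ∈ T₂,
      ∑ X₁ ∈ ({∅, X} : Finset (Finset (Fin d → ZMod M))),
        (((∏ _B ∈ blocks (L ^ k) (U \ X), (Real.exp (1 / 4) + (16 * Real.exp (3 / 8) * hamNorm (fieldWt h (L : ℝ) d k) ((L : ℝ) ^ k) (L ^ (d * k)) (Ht - Ht')))) -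
            ∏ _B ∈ blocks (L ^ k) (U \ X), Real.exp (1 / 4)) *
            (∏ _B ∈ blocks (L ^ k) (X \ U), Real.exp (1 / 4)) *
            ((∏ _B ∈ blocks (L ^ k) X₁, 8 * Real.exp (1 / 4) * τ) *
              ((∑ Y ∈ polys (L ^ k) (X \ X₁), (∏ _B ∈ blocks (L ^ k) ((X \ X₁) \ Y),
                8 * Real.exp (1 / 4) * hamNorm (fieldWt h (L : ℝ) d k) ((L : ℝ) ^ k) (L ^ (d * k)) H) *
                ∏ Z ∈ components Y, C * P.aFactor k Z) *
                A𝒫 ^ numBlocks (L ^ k) (X \ X₁))) +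
          (∏ _B ∈ blocks (L ^ k) (U \ X), Real.exp (1 / 4)) *
            ((∏ _B ∈ blocks (L ^ k) (X \ U), (Real.exp (1 / 4) + (16 * Real.exp (3 / 8) * hamNorm (fieldWt h (L : ℝ) d k) ((L : ℝ) ^ k) (L ^ (d * k)) (Ht - Ht')))) -
              ∏ _B ∈ blocks (L ^ k) (X \ U), Real.exp (1 / 4)) *
            ((∏ _B ∈ blocks (L ^ k) X₁, 8 * Real.exp (1 / 4) * τ) *
              ((∑ Y ∈ polys (L ^ k) (X \ X₁), (∏ _B ∈ blocks (L ^ k) ((X \ X₁) \ Y),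
                8 * Real.exp (1 / 4) * hamNorm (fieldWt h (L : ℝ) d k) ((L : ℝ) ^ k) (L ^ (d * k)) H) *
                ∏ Z ∈ components Y, C * P.aFactor k Z) *
                A𝒫 ^ numBlocks (L ^ k) (X \ X₁))) +
          (∏ _B ∈ blocks (L ^ k) (U \ X), Real.exp (1 / 4)) * (∏ _B ∈ blocks (L ^ k) (X \ U), Real.exp (1 / 4)) *
            (((∏ _B ∈ blocks (L ^ k) X₁, (8 * Real.exp (1 / 4) * τ + (16 * Real.exp (3 / 8) * hamNorm (fieldWt h (L : ℝ) d k) ((L : ℝ) ^ k) (L ^ (d * k)) (Ht - Ht')))) -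
              ∏ _B ∈ blocks (L ^ k) X₁, 8 * Real.exp (1 / 4) * τ) *
              ((∑ Y ∈ polys (L ^ k) (X \ X₁), (∏ _B ∈ blocks (L ^ k) ((X \ X₁) \ Y),
                8 * Real.exp (1 / 4) * hamNorm (fieldWt h (L : ℝ) d k) ((L : ℝ) ^ k) (L ^ (d * k)) H) *
                ∏ Z ∈ components Y, C * P.aFactor k Z) *
                A𝒫 ^ numBlocks (L ^ k) (X \ X₁))) +
          (∏ _B ∈ blocks (L ^ k) (U \ X), Real.exp (1 / 4)) * (∏ _B ∈ blocks (L ^ k) (X \ U), Real.exp (1 / 4)) *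
            ((∏ _B ∈ blocks (L ^ k) X₁, 8 * Real.exp (1 / 4) * τ) *
              ((∑ Y ∈ polys (L ^ k) (X \ X₁),
                (((∏ _B ∈ blocks (L ^ k) ((X \ X₁) \ Y),
                    (8 * Real.exp (1 / 4) * hamNorm (fieldWt h (L : ℝ) d k) ((L : ℝ) ^ k) (L ^ (d * k)) H' + 16 * Real.exp (3 / 8) * hamNorm (fieldWt h (L : ℝ) d k) ((L : ℝ) ^ k) (L ^ (d * k)) (H - H'))) -
                  ∏ _B ∈ blocks (L ^ k) ((X \ X₁) \ Y),
                    8 * Real.exp (1 / 4) * hamNorm (fieldWt h (L : ℝ) d k) ((L : ℝ) ^ k) (L ^ (d * k)) H') *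
                  ∏ Z ∈ components Y, C * P.aFactor k Z +
                (∏ _B ∈ blocks (L ^ k) ((X \ X₁) \ Y),
                    8 * Real.exp (1 / 4) * hamNorm (fieldWt h (L : ℝ) d k) ((L : ℝ) ^ k) (L ^ (d * k)) H') *
                  ((∏ Z ∈ components Y, (C * P.aFactor k Z + CΔ * P.aFactor k Z)) -
                    ∏ Z ∈ components Y, C * P.aFactor k Z))) *
                A𝒫 ^ numBlocks (L ^ k) (X \ X₁)))) ≤
        (∑ X₁ ∈ ({∅, X} : Finset (Finset (Fin d → ZMod M))), ∑ Y ∈ 𝓩 X X₁, G X Y) +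
          c ^ (blocks (L ^ k) X).card * E₂ * (A ^ (blocks (L ^ k) X).card)⁻¹ := by
    intro X hX
    have hXp := hT₂p X hX
    have hXne : (∅ : Finset (Fin d → ZMod M)) ≠ X := (hT₂ne X hX).ne_empty.symm
    rw [sum_pair hXne, sum_pair hXne]
    have h𝓩0 : 𝓩 X ∅ = (polys (L ^ k) (X \ ∅)).erase X := by simp only [h𝓩, if_pos rfl]
    have h𝓩X : 𝓩 X X = polys (L ^ k) (X \ X) := by simp only [h𝓩, if_neg hXne.symm]
    rw [h𝓩0, h𝓩X]
    -- `X₁ = ∅`: the top-term adapter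
    have hAempty := reblockTerm_lipschitzConsts_le_top (U := U) (X := X) (X₁ := (∅ : Finset (Fin d → ZMod M)))
      hMo hsodd hA1 (Real.exp_pos _).le
      h3 (by positivity) (by have := hnn H; positivity)
      (by have := hnn H'; positivity) (by have := hnn (H - H'); positivity) hC hCΔ hA𝒫 hθω hbω hb'ω hCω hωA hκ
      haF hXp rfl (hT₂two X hX)
    -- `X₁ = X`: the ordinary adapter (`𝓟(X∖X) = {∅}`, degree `|X|_k ≥ 2`)
    have hdegX : ∀ Y ∈ polys (L ^ k) (X \ X), 2 ≤ (blocks (L ^ k) (X \ Y)).card + (components Y).card := by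
      intro Y hY
      rw [Finset.sdiff_self, polys_empty, mem_singleton] at hY
      subst hY
      rw [sdiff_empty]
      exact (hT₂two X hX).trans (Nat.le_add_right _ _)
    have hAX := reblockTerm_lipschitzConsts_le (U := U) (X := X) (X₁ := X) hMo hsodd hA1 (Real.exp_pos _).le
      h3 (by positivity) (by have := hnn H; positivity)
      (by have := hnn H'; positivity) (by have := hnn (H - H'); positivity) hC hCΔ hA𝒫 hθω hbω hb'ω hCω hωA hκ
      haF hXp (self_mem_polys hXp) hdegX
    have hsum : (∑ Y ∈ (polys (L ^ k) (X \ ∅)).erase X, G X Y) +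
        c ^ (blocks (L ^ k) X).card * E₂ * (A ^ (blocks (L ^ k) X).card)⁻¹ + ∑ Y ∈ polys (L ^ k) (X \ X), G X Y =
        (∑ Y ∈ (polys (L ^ k) (X \ ∅)).erase X, G X Y) + ∑ Y ∈ polys (L ^ k) (X \ X), G X Y +
          c ^ (blocks (L ^ k) X).card * E₂ * (A ^ (blocks (L ^ k) X).card)⁻¹ := by ring
    rw [← hsum]
    exact add_le_add hAempty hAX
  -- Step 2: sum over `X` and the two master bounds
  have hsplit : ∀ X ∈ T₂, (∑ X₁ ∈ ({∅, X} : Finset (Finset (Fin d → ZMod M))), ∑ Y ∈ 𝓩 X X₁, G X Y) +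
      c ^ (blocks (L ^ k) X).card * E₂ * (A ^ (blocks (L ^ k) X).card)⁻¹ =
      (fun X => (∑ X₁ ∈ ({∅, X} : Finset (Finset (Fin d → ZMod M))), ∑ Y ∈ 𝓩 X X₁, G X Y)) X +
        (fun X => c ^ (blocks (L ^ k) X).card * E₂ * (A ^ (blocks (L ^ k) X).card)⁻¹) X := fun X _ => rfl
  refine (sum_le_sum hstep).trans ?_
  rw [sum_add_distrib]
  refine add_le_add ?_ ?_
  · have hm := sum_reblock_triples_le_pow (d := d) hLodd hL2 hL4 hM hkN hA1 hc1 hE0 hU' (𝓧' := T₂) hT₂T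
      (𝓨 := fun X => ({∅, X} : Finset (Finset (Fin d → ZMod M)))) h𝓨 (𝓩 := 𝓩) h𝓩sub (F := fun X _ Y => G X Y)
      (fun X _ X₁ _ Y _ => by simp only [hG]; exact le_rfl)
    simpa only [hE, hc] using hm
  · have hm := sum_reblock_large_le_pow (d := d) hLodd hL2 hL4 hM hkN hA1 hc1 hE₂0 hU' (𝓧'' := T₂) hT₂T hT₂c
      hT₂two (F := fun X => c ^ (blocks (L ^ k) X).card * E₂ * (A ^ (blocks (L ^ k) X).card)⁻¹)
      (fun X _ => le_rfl)
    simpa only [hE₂, hc] using hm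

end Literature.MathematicalPhysics.StatisticalMechanics.GradientRG

end
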